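import Summits.Ventures.PercRepro.Night2LocalD2R14SixOneC

/-!
# PercRepro — the six-element columns of R1₄ with one far preimage, part D: the bound (night-2, gen 16)

With exactly one far preimage `B₀` at a six-element shadow set `S` of the coloop cell (simple matroid):

* `sum_r14Pair_le_of_one_far`: the pair part is at most `41/75` once `|G ∖ S| ≥ 3` — the traces
  `(G ∖ S) ∩ cl (B ∩ B₀)` of the non-far pair preimages are pairwise disjoint across the three possible `B ∩ B₀`
  (Night2LocalD2R14SixOneC), so at most one of them has `≥ |G ∖ S| − 1` points, i.e. at most two non-far pair
  preimages have `|G ∖ cl B| = 3` (weight `2/25`), the other ≤ 4 have weight `≤ 2/75`;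
* **`sum_r14W_col_le_of_card_six_of_one_far`**: the column is `≤ 1` (`≤ 163/175` without the identity preimage,
  `≤ 2/5 + 41/75 + 3/70 < 1` with it, where `|G ∖ S| ≥ 3` because `S ∖ {y}` is a member);
* **`sum_r14W_col_le_of_card_six_of_far`**: the column at a six-element shadow set with a far preimage is `≤ 1`
  (with Night2LocalD2R14SixFar for two far preimages).
-/

namespace PercRepro.Shadow

open Finset PerFlat ThmH

variable {α : Type*} [DecidableEq α] {M : Matroid α} [M.Finite]

open scoped Classical in
/-- With exactly one far preimage `B₀`, every other pair preimage has `|G ∖ cl B| ≥ 3`. -/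
theorem three_le_card_sdiff_clF_of_one_far {G S B₀ : Finset α} (h₀ : B₀ ∈ opFarPre M G S)
    (hf : (opFarPre M G S).card ≤ 1) {B : Finset α} (hB : B ∈ pairPre M 4 G S) (hne : B ≠ B₀) :
    3 ≤ (G \ clF M B).card := by
  have h2 := two_le_card_sdiff_clF_of_mem_pairPre hB
  by_contra h
  have hm : (G \ clF M B).card = 2 := by omega
  have hBf : B ∈ opFarPre M G S := mem_opFarPre_iff_mem_pairPre.2 ⟨hB, hm⟩
  exact hne (Finset.card_le_one.1 hf B hBf B₀ h₀)

open scoped Classical in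
/-- **The pair part with exactly one far preimage** (`|G ∖ S| ≥ 3`, simple): at most `41/75`. -/
theorem sum_r14Pair_le_of_one_far {G : Finset α} (hG : G ∈ flatsQ M (4 + 1)) (hd : (gr M \ G).card = 2)
    (hsimple : ∀ e ∈ gr M, ∀ f ∈ gr M, e ≠ f → rkN M {e, f} = 2) {y : α} (hyG : y ∈ G)
    (hyc : y ∉ clF M (G.erase y)) {S : Finset α} (hS : S ∈ shadowAt M (4 + 2) 4 (Uq M (4 + 2) 4) G)
    (h6 : S.card = 6) {B₀ : Finset α} (h₀ : B₀ ∈ opFarPre M G S) (hf : (opFarPre M G S).card ≤ 1)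
    (hq : 3 ≤ (G \ S).card) : ∑ B ∈ pairPre M 4 G S, r14Pair M G B ≤ 41 / 75 := by
  have hp₀ : B₀ ∈ pairPre M 4 G S := opFarPre_subset_pairPre G S h₀
  have hB₀S := subset_of_mem_opFarPre h₀
  have hB₀4 := card_eq_four_of_mem_opFarPre h₀ h6
  have hy₀ := mem_of_mem_opFarPre hG hyG hyc h₀
  set P' := (pairPre M 4 G S).erase B₀ with hP'def
  -- the traces and the special `T`
  set τ : Finset α → Finset α := fun B => B ∩ B₀ with hτdef
  set 𝒯 := P'.image τ with h𝒯def
  have h𝒯 : ∀ T ∈ 𝒯, T ⊆ B₀ ∧ T.card = 3 ∧ y ∈ T := by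
    intro T hT
    rw [h𝒯def, Finset.mem_image] at hT
    obtain ⟨B, hB, rfl⟩ := hT
    rw [hP'def, Finset.mem_erase] at hB
    obtain ⟨hc, hy⟩ := card_inter_far_eq_three hG hd hyG hyc h₀ h6 hB.2 hB.1
    exact ⟨Finset.inter_subset_right, hc, hy⟩
  have hdisj : ∀ T ∈ 𝒯, ∀ T' ∈ 𝒯, T ≠ T' → Disjoint ((G \ S) ∩ clF M T) ((G \ S) ∩ clF M T') := by
    intro T hT T' hT' hne
    obtain ⟨h1, h2, h3⟩ := h𝒯 T hT
    obtain ⟨h1', h2', h3'⟩ := h𝒯 T' hT'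
    exact disjoint_trace_of_ne hG hsimple hyG hyc hS h₀ h6 h1 h1' h2 h2' h3 h3' hne
  have hsum : ∑ T ∈ 𝒯, ((G \ S) ∩ clF M T).card ≤ (G \ S).card := by
    rw [← Finset.card_biUnion hdisj]
    exact Finset.card_le_card (Finset.biUnion_subset.2 (fun T _ => Finset.inter_subset_left))
  set 𝒯' := 𝒯.filter (fun T => (G \ S).card - 1 ≤ ((G \ S) ∩ clF M T).card) with h𝒯'def
  have h𝒯'1 : 𝒯'.card ≤ 1 := by
    rw [Finset.card_le_one]
    intro T hT T' hT'
    by_contra hne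
    rw [h𝒯'def, Finset.mem_filter] at hT hT'
    have h1 : ((G \ S) ∩ clF M T).card + ((G \ S) ∩ clF M T').card ≤ ∑ U ∈ 𝒯, ((G \ S) ∩ clF M U).card := by
      have := Finset.sum_le_sum_of_subset_of_nonneg (f := fun U => ((G \ S) ∩ clF M U).card)
        (Finset.insert_subset hT.1 (Finset.singleton_subset_iff.2 hT'.1)) (fun _ _ _ => Nat.zero_le _)
      rw [Finset.sum_pair hne] at this
      exact this
    omega
  -- termwise bound on `P'`
  have hterm : ∀ B ∈ P', r14Pair M G B ≤ (if τ B ∈ 𝒯' then 2 / 25 else 2 / 75) := by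
    intro B hB
    have hB' := hB
    rw [hP'def, Finset.mem_erase] at hB'
    split_ifs with hT
    · exact r14Pair_le_of_three_le (three_le_card_sdiff_clF_of_one_far h₀ hf hB'.2 hB'.1)
    · apply r14Pair_le_of_four_le
      have hc := card_sdiff_clF_add_card_inter_ge hG hd hsimple hyG hyc hS h₀ h6 hB'.2 hB'.1
      have hτB : τ B ∈ 𝒯 := Finset.mem_image_of_mem τ hB
      have hsmall : ((G \ S) ∩ clF M (B ∩ B₀)).card + 2 ≤ (G \ S).card := by
        by_contra hcon
        apply hT
        rw [h𝒯'def, Finset.mem_filter]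
        refine ⟨hτB, ?_⟩
        show (G \ S).card - 1 ≤ ((G \ S) ∩ clF M (B ∩ B₀)).card
        omega
      omega
  -- the fibre of `τ` over a trace `T` has at most two elements
  have hfib : ∀ T ∈ 𝒯, (P'.filter (fun B => τ B = T)).card ≤ 2 := by
    intro T hT
    obtain ⟨hTB₀, hTc, -⟩ := h𝒯 T hT
    have hTS : T ⊆ S := hTB₀.trans hB₀S
    -- `S ∖ B` is a 2-subset of the 3-set `S ∖ T` different from `S ∖ B₀`
    have hmaps : ∀ B ∈ P'.filter (fun B => τ B = T), S \ B ∈ (Finset.powersetCard 2 (S \ T)).erase (S \ B₀) := by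
      intro B hB
      rw [Finset.mem_filter, hP'def, Finset.mem_erase] at hB
      obtain ⟨⟨hne, hBp⟩, hτB⟩ := hB
      rw [Finset.mem_erase, Finset.mem_powersetCard]
      refine ⟨sdiff_ne_of_mem_pairPre hBp hp₀ hne, ?_, card_sdiff_of_mem_pairPre hBp⟩
      intro t ht
      rw [Finset.mem_sdiff] at ht ⊢
      refine ⟨ht.1, fun htT => ht.2 ?_⟩
      rw [← hτB] at htT
      exact (Finset.mem_inter.1 htT).1
    have hinj : Set.InjOn (fun B => S \ B) ((P'.filter (fun B => τ B = T)) : Set (Finset α)) := by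
      intro B hB B' hB' h
      rw [Finset.mem_coe, Finset.mem_filter, hP'def, Finset.mem_erase] at hB hB'
      by_contra hne
      exact sdiff_ne_of_mem_pairPre hB.1.2 hB'.1.2 hne h
    have h1 := Finset.card_le_card_of_injOn (fun B => S \ B) hmaps hinj
    have hST : (S \ T).card = 3 := by
      have := Finset.card_sdiff_add_card_eq_card hTS
      omega
    have h4 : S \ B₀ ∈ Finset.powersetCard 2 (S \ T) := by
      rw [Finset.mem_powersetCard]
      refine ⟨Finset.sdiff_subset_sdiff (le_refl _) hTB₀, ?_⟩
      rw [sdiff_eq_of_mem_opFarPre h₀]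
      exact (mem_opFarPre.1 h₀).2.1
    rw [Finset.card_erase_of_mem h4, Finset.card_powersetCard, hST] at h1
    have h33 : Nat.choose 3 2 = 3 := by decide
    omega
  -- the special fibres together have at most two elements
  have hin : (P'.filter (fun B => τ B ∈ 𝒯')).card ≤ 2 := by
    have hsub : P'.filter (fun B => τ B ∈ 𝒯') ⊆ 𝒯'.biUnion (fun T => P'.filter (fun B => τ B = T)) := by
      intro B hB
      rw [Finset.mem_filter] at hB
      rw [Finset.mem_biUnion]
      exact ⟨τ B, hB.2, Finset.mem_filter.2 ⟨hB.1, rfl⟩⟩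
    have h1 := Finset.card_le_card hsub
    have h2 := Finset.card_biUnion_le (s := 𝒯') (t := fun T => P'.filter (fun B => τ B = T))
    have h3 : ∑ T ∈ 𝒯', (P'.filter (fun B => τ B = T)).card ≤ ∑ _T ∈ 𝒯', 2 :=
      Finset.sum_le_sum (fun T hT => hfib T (Finset.mem_of_mem_filter T hT))
    rw [Finset.sum_const, smul_eq_mul] at h3
    omega
  have hP'6 : P'.card ≤ 6 := by
    rw [hP'def, Finset.card_erase_of_mem hp₀]
    have := card_pairPre_le_seven_of_far hG hd hyG hyc hS h6 h₀
    omega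
  -- assemble
  have hsplit := Finset.add_sum_erase (pairPre M 4 G S) (fun B => r14Pair M G B) hp₀
  rw [← hP'def] at hsplit
  rw [← hsplit, r14Pair_eq_of_two (mem_opFarPre.1 h₀).2.1]
  have hP' : ∑ B ∈ P', r14Pair M G B ≤ 20 / 75 := by
    calc ∑ B ∈ P', r14Pair M G B ≤ ∑ B ∈ P', (if τ B ∈ 𝒯' then (2 : ℚ) / 25 else 2 / 75) :=
          Finset.sum_le_sum hterm
      _ = ∑ B ∈ P', ((2 : ℚ) / 75 + (if τ B ∈ 𝒯' then (4 : ℚ) / 75 else 0)) := by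
          apply Finset.sum_congr rfl
          intro B _
          split_ifs <;> norm_num
      _ = (P'.card : ℚ) * (2 / 75) + ((P'.filter (fun B => τ B ∈ 𝒯')).card : ℚ) * (4 / 75) := by
          rw [Finset.sum_add_distrib, Finset.sum_const, nsmul_eq_mul, ← Finset.sum_filter, Finset.sum_const,
            nsmul_eq_mul]
      _ ≤ 6 * (2 / 75) + 2 * (4 / 75) := by
          have h1 : (P'.card : ℚ) ≤ 6 := by exact_mod_cast hP'6
          have h2 : ((P'.filter (fun B => τ B ∈ 𝒯')).card : ℚ) ≤ 2 := by exact_mod_cast hin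
          nlinarith
      _ = 20 / 75 := by norm_num
  linarith

open scoped Classical in
/-- When `S ∖ {y}` is a member (an identity preimage), `|G ∖ S| ≥ 3`. -/
theorem three_le_card_sdiff_of_idPre {G : Finset α} (hG : G ∈ flatsQ M (4 + 1)) (hd : (gr M \ G).card = 2)
    {y : α} (hyG : y ∈ G) (hyc : y ∉ clF M (G.erase y)) (hP : ∀ z ∈ G.erase y, 4 ≤ rkN M ((G.erase y).erase z))
    {S : Finset α} (hS : S ∈ shadowAt M (4 + 2) 4 (Uq M (4 + 2) 4) G) {B : Finset α} (hB : B ∈ r14IdPre M G S) :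
    3 ≤ (G \ S).card := by
  have hyS : y ∈ S := mem_of_mem_shadowAt_of_coloop (by rw [rkN_erase_eq_of_coloop hG hyG hyc]) hS
  unfold r14IdPre at hB
  rw [Finset.mem_filter] at hB
  have hBeq := eq_erase_coloop_of_coverPreimage_card_one hG hyG hyc hP hB.1 hB.2.1 hyS
  have hBU : B ∈ Uq M (4 + 2) 4 := (mem_membersIn.1 (mem_coverPreimages.1 hB.1).1).1
  have h6 := rkN_sdiff_eq_of_mem_Uq hBU
  rw [hBeq] at h6
  have h1 : gr M \ S.erase y ⊆ ((G \ S) ∪ {y}) ∪ (gr M \ G) := by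
    intro t ht
    rw [Finset.mem_sdiff, Finset.mem_erase, not_and] at ht
    rw [Finset.mem_union, Finset.mem_union, Finset.mem_sdiff, Finset.mem_singleton]
    by_cases htG : t ∈ G
    · by_cases htS : t ∈ S
      · exact Or.inl (Or.inr (by by_contra h; exact ht.2 h htS))
      · exact Or.inl (Or.inl ⟨htG, htS⟩)
    · exact Or.inr (Finset.mem_sdiff.2 ⟨ht.1, htG⟩)
  have h2 := rkN_mono (M := M) h1
  have h3 := rkN_union_le_rkN_add_card (M := M) ((G \ S) ∪ {y}) (gr M \ G)
  have h4 := rkN_union_le_rkN_add_card (M := M) (G \ S) {y}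
  have h5 := rkN_le_card_fin (M := M) (G \ S)
  rw [Finset.card_singleton] at h4
  omega

open scoped Classical in
/-- **The column of R1₄ at a six-element shadow set with exactly one far preimage is at most `1`.** -/
theorem sum_r14W_col_le_of_card_six_of_one_far {G : Finset α} (hG : G ∈ flatsQ M (4 + 1))
    (hd : (gr M \ G).card = 2) (hsimple : ∀ e ∈ gr M, ∀ f ∈ gr M, e ≠ f → rkN M {e, f} = 2) {y : α}
    (hyG : y ∈ G) (hyc : y ∉ clF M (G.erase y)) (hP : ∀ z ∈ G.erase y, 4 ≤ rkN M ((G.erase y).erase z))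
    {S : Finset α} (hS : S ∈ shadowAt M (4 + 2) 4 (Uq M (4 + 2) 4) G) (h6 : S.card = 6)
    (hf : (opFarPre M G S).card = 1) : ∑ B ∈ membersIn M (Uq M (4 + 2) 4) G, r14W M G B S ≤ 1 := by
  obtain ⟨B₀, hB₀⟩ := Finset.card_eq_one.1 hf
  have h₀ : B₀ ∈ opFarPre M G S := by rw [hB₀]; exact Finset.mem_singleton_self _
  have hp₀ : B₀ ∈ pairPre M 4 G S := opFarPre_subset_pairPre G S h₀
  have hparts := sum_r14W_col_le_parts (M := M) G S
  rw [r14KeepPre_eq_empty (by omega), Finset.sum_empty, r14CovPre_eq_empty_of_far hG hd hyG hyc h₀,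
    Finset.sum_empty, r14PairPre_eq_pairPre] at hparts
  have hspread := r14Spread_le_of_far hG hd hyG hyc hP hS h6 h₀
  have hι := card_r14IdPre_le_one hG hyG hyc hP hS
  have hq0 : (0 : ℚ) ≤ ((G \ S).card : ℚ) := Nat.cast_nonneg _
  -- the crude pair bound `19/25`
  have hpair0 : ∑ B ∈ pairPre M 4 G S, r14Pair M G B ≤ 19 / 25 := by
    have hsplit := Finset.add_sum_erase (pairPre M 4 G S) (fun B => r14Pair M G B) hp₀
    rw [← hsplit, r14Pair_eq_of_two (mem_opFarPre.1 h₀).2.1]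
    have hP'6 : ((pairPre M 4 G S).erase B₀).card ≤ 6 := by
      rw [Finset.card_erase_of_mem hp₀]
      have := card_pairPre_le_seven_of_far hG hd hyG hyc hS h6 h₀
      omega
    have : ∑ B ∈ (pairPre M 4 G S).erase B₀, r14Pair M G B ≤ (((pairPre M 4 G S).erase B₀).card : ℚ) * (2 / 25) := by
      rw [← nsmul_eq_mul, ← Finset.sum_const]
      apply Finset.sum_le_sum
      intro B hB
      rw [Finset.mem_erase] at hB
      exact r14Pair_le_of_three_le (three_le_card_sdiff_clF_of_one_far h₀ (le_of_eq hf) hB.2 hB.1)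
    have h6' : (((pairPre M 4 G S).erase B₀).card : ℚ) ≤ 6 := by exact_mod_cast hP'6
    nlinarith
  rcases Nat.eq_zero_or_pos (r14IdPre M G S).card with h0 | hpos
  · -- no identity preimage
    rw [h0] at hparts
    have hsp : r14Spread M G S ≤ 6 / 35 := by
      have : (3 / 35 : ℚ) / (((G \ S).card : ℚ) + 1) ≤ 3 / 35 := by
        rw [div_le_iff₀ (by positivity)]
        nlinarith
      linarith
    simp only [Nat.cast_zero, zero_mul, zero_add] at hparts
    linarith
  · -- an identity preimage: `|G ∖ S| ≥ 3`
    obtain ⟨B, hB⟩ := Finset.card_pos.1 hpos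
    have hq := three_le_card_sdiff_of_idPre hG hd hyG hyc hP hS hB
    have hpair := sum_r14Pair_le_of_one_far hG hd hsimple hyG hyc hS h6 h₀ (le_of_eq hf) hq
    have hsp : r14Spread M G S ≤ 3 / 70 := by
      have hq' : (3 : ℚ) ≤ ((G \ S).card : ℚ) := by exact_mod_cast hq
      have : (3 / 35 : ℚ) / (((G \ S).card : ℚ) + 1) ≤ 3 / 140 := by
        rw [div_le_iff₀ (by positivity)]
        nlinarith
      linarith
    have hι' : ((r14IdPre M G S).card : ℚ) ≤ 1 := by exact_mod_cast hι
    nlinarith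

open scoped Classical in
/-- **The column of R1₄ at a six-element shadow set with a far preimage is at most `1`.** -/
theorem sum_r14W_col_le_of_card_six_of_far {G : Finset α} (hG : G ∈ flatsQ M (4 + 1))
    (hd : (gr M \ G).card = 2) (hsimple : ∀ e ∈ gr M, ∀ f ∈ gr M, e ≠ f → rkN M {e, f} = 2) {y : α}
    (hyG : y ∈ G) (hyc : y ∉ clF M (G.erase y)) (hP : ∀ z ∈ G.erase y, 4 ≤ rkN M ((G.erase y).erase z))
    {S : Finset α} (hS : S ∈ shadowAt M (4 + 2) 4 (Uq M (4 + 2) 4) G) (h6 : S.card = 6)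
    (hf : 1 ≤ (opFarPre M G S).card) : ∑ B ∈ membersIn M (Uq M (4 + 2) 4) G, r14W M G B S ≤ 1 := by
  rcases Nat.lt_or_ge (opFarPre M G S).card 2 with h | h
  · exact sum_r14W_col_le_of_card_six_of_one_far hG hd hsimple hyG hyc hP hS h6 (by omega)
  · exact sum_r14W_col_le_of_card_six_of_two_far hG hd hyG hyc hP h6 h

end PercRepro.Shadow
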